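import Literature.NumberTheory.Transcendental.KZCubeRationalMoves

/-!
# `ReductionRigidity` (stmt-KontsevichZagierPeriods-3407), line `Sketch`, stub `stub_islandComplement`:
# subdivision of the cube at a RATIONAL height (`stub_subdivAt`)

Route `KontsevichZagierPeriods/HermiteRigidity`, crux `ReductionRigidity` (stmt-3407); a tool for growth
deliverable G5 (the five-term relation as a chain of moves) of
`Cruxes/ReductionRigidity/STUB-PLAN-stub_islandComplement.md`. The cubical kit
(`KZCubicalCalculus.lean`) subdivides the closed cube DYADICALLY (`KZ.cubicalSubdivGens`, height `½`);
the five-term chain needs the subdivision of `□ᴹ` along a coordinate `xᵢ` at an arbitrary rational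
height `0 < c < 1`, with the two pieces rescaled back to the whole cube:

  `[□ᴹ, T] ≡ [□ᴹ, c · T(x with xᵢ := c xᵢ)] + [□ᴹ, (1 − c) · T(x with xᵢ := c + (1 − c) xᵢ)]`

for regular rational functions (`stub_subdivAt`, no side condition) — one domain additivity across the
null hyperplane `xᵢ = c` (rule 1a) and two change-of-variables moves along the affine rescalings of
Jacobians `c` and `1 − c` (rule 2), exactly as in `KZ.cubicalSubdivGens_subset_relations`.

References: M. Kontsevich, D. Zagier, *Periods* (2001), §1.2 rules (1), (2)
[cite: KontsevichZagier2001, §1.2]. No definitions are introduced (the rescaling is the explicit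
diagonal matrix `diag(1, …, t, …, 1)`).
-/

noncomputable section

open MeasureTheory Set MvPolynomial

namespace Summit.KontsevichZagierPeriods.HermiteRigidity.ReductionRigidity

open Literature.NumberTheory.Transcendental
open Literature.NumberTheory.Transcendental.KZ
open Literature.ModelTheory.ExponentialFields (IsSemialgebraic)

/-! ## The two pieces of the cube -/

/-- The lower piece `{x ∈ □ᴹ | xᵢ ≤ c}` and the upper piece `{x ∈ □ᴹ | c ≤ xᵢ}` cover the cube.
[folklore] -/
theorem lowerAt_union_upperAt {M : ℕ} (i : Fin M) (c : ℝ) :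
    {x : Fin M → ℝ | x ∈ cube M ∧ x i ≤ c} ∪ {x | x ∈ cube M ∧ c ≤ x i} = cube M := by
  ext x
  simp only [mem_union, mem_setOf_eq]
  constructor
  · rintro (h | h) <;> exact h.1
  · intro h
    rcases le_total (x i) c with h' | h'
    · exact Or.inl ⟨h, h'⟩
    · exact Or.inr ⟨h, h'⟩

/-- The two pieces overlap in a Lebesgue-null set (a piece of the hyperplane `xᵢ = c`). [folklore] -/
theorem volume_lowerAt_inter_upperAt {M : ℕ} (i : Fin M) (c : ℝ) :
    volume ({x : Fin M → ℝ | x ∈ cube M ∧ x i ≤ c} ∩ {x | x ∈ cube M ∧ c ≤ x i}) = 0 := by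
  have h : {x : Fin M → ℝ | x ∈ cube M ∧ x i ≤ c} ∩ {x | x ∈ cube M ∧ c ≤ x i} ⊆
      {x : Fin M → ℝ | x i = c} := fun x hx => le_antisymm hx.1.2 hx.2.2
  exact measure_mono_null h (Measure.pi_hyperplane (fun _ : Fin M => (volume : Measure ℝ)) i _)

/-- The lower piece at a rational height is `ℚ`-semialgebraic. [folklore] -/
theorem isSemialgebraic_lowerAt {M : ℕ} (i : Fin M) (c : ℚ) :
    IsSemialgebraic ℚ {x : Fin M → ℝ | x ∈ cube M ∧ x i ≤ (c:ℝ)} := by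
  have h : {x : Fin M → ℝ | x ∈ cube M ∧ x i ≤ (c:ℝ)} =
      cube M ∩ {x : Fin M → ℝ | aeval x (X i : MvPolynomial (Fin M) ℚ) ≤
        aeval x (C c : MvPolynomial (Fin M) ℚ)} := by
    ext x
    simp
  rw [h]
  exact isSemialgebraic_cube.inter
    (Literature.ModelTheory.ExponentialFields.isSemialgebraic_setOf_eval_le _ _)

/-- The upper piece at a rational height is `ℚ`-semialgebraic. [folklore] -/
theorem isSemialgebraic_upperAt {M : ℕ} (i : Fin M) (c : ℚ) :
    IsSemialgebraic ℚ {x : Fin M → ℝ | x ∈ cube M ∧ (c:ℝ) ≤ x i} := by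
  have h : {x : Fin M → ℝ | x ∈ cube M ∧ (c:ℝ) ≤ x i} =
      cube M ∩ {x : Fin M → ℝ | aeval x (C c : MvPolynomial (Fin M) ℚ) ≤
        aeval x (X i : MvPolynomial (Fin M) ℚ)} := by
    ext x
    simp
  rw [h]
  exact isSemialgebraic_cube.inter
    (Literature.ModelTheory.ExponentialFields.isSemialgebraic_setOf_eval_le _ _)

/-! ## The rescaling `v ↦ (v with vᵢ ↦ t vᵢ)` as the diagonal matrix `diag(1, …, t, …, 1)` -/

/-- `diag(1, …, t, …, 1) v = (v with vᵢ ↦ t vᵢ)`. [folklore] -/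
theorem scaleAt_apply {M : ℕ} (i : Fin M) (t : ℝ) (v : Fin M → ℝ) :
    (LinearMap.toContinuousLinearMap
      (Matrix.toLin' (Matrix.diagonal fun j : Fin M => if j = i then t else 1))) v =
      Function.update v i (t * v i) := by
  ext j
  simp only [LinearMap.coe_toContinuousLinearMap', Matrix.toLin'_apply, Matrix.mulVec_diagonal]
  by_cases hj : j = i
  · subst hj; simp
  · simp [hj]

/-- The Jacobian determinant of the rescaling is `t`. [folklore] -/
theorem det_scaleAt {M : ℕ} (i : Fin M) (t : ℝ) :
    (LinearMap.toContinuousLinearMap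
      (Matrix.toLin' (Matrix.diagonal fun j : Fin M => if j = i then t else 1)) :
        (Fin M → ℝ) →L[ℝ] (Fin M → ℝ)).det = t := by
  simp [LinearMap.det_toLin', Matrix.det_diagonal, Finset.prod_ite_eq']

/-- The lower rescaling `x ↦ (x with xᵢ ↦ c xᵢ)` is the linear map `diag(1, …, c, …, 1)`. [folklore] -/
theorem lowerMapAt_eq {M : ℕ} (i : Fin M) (c : ℝ) :
    (fun x : Fin M → ℝ => Function.update x i (c * x i)) =
      ⇑(LinearMap.toContinuousLinearMap
        (Matrix.toLin' (Matrix.diagonal fun j : Fin M => if j = i then c else 1))) :=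
  funext fun v => (scaleAt_apply i c v).symm

/-- The upper rescaling `x ↦ (x with xᵢ ↦ c + (1 − c) xᵢ)` is `diag(1, …, 1 − c, …, 1)` followed by the
translation by `c eᵢ`. [folklore] -/
theorem upperMapAt_eq {M : ℕ} (i : Fin M) (c : ℝ) :
    (fun x : Fin M → ℝ => Function.update x i (c + (1 - c) * x i)) =
      fun x => (LinearMap.toContinuousLinearMap
        (Matrix.toLin' (Matrix.diagonal fun j : Fin M => if j = i then (1 - c) else 1))) x +
          Pi.single i c := by
  funext x
  ext j
  rw [scaleAt_apply]
  by_cases hj : j = i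
  · subst hj; simp; ring
  · simp [hj]

/-- The lower rescaling is injective for `c ≠ 0`. [folklore] -/
theorem lowerMapAt_injective {M : ℕ} (i : Fin M) {c : ℝ} (hc : c ≠ 0) :
    Function.Injective (fun x : Fin M → ℝ => Function.update x i (c * x i)) := by
  intro x y h
  ext j
  have hj := congr_fun h j
  by_cases hji : j = i
  · subst hji
    simp only [Function.update_self] at hj
    exact mul_left_cancel₀ hc hj
  · simpa [Function.update_of_ne hji] using hj

/-- The upper rescaling is injective for `c ≠ 1`. [folklore] -/
theorem upperMapAt_injective {M : ℕ} (i : Fin M) {c : ℝ} (hc : c ≠ 1) :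
    Function.Injective (fun x : Fin M → ℝ => Function.update x i (c + (1 - c) * x i)) := by
  intro x y h
  ext j
  have hj := congr_fun h j
  by_cases hji : j = i
  · subst hji
    simp only [Function.update_self, add_right_inj] at hj
    exact mul_left_cancel₀ (sub_ne_zero.mpr (Ne.symm hc)) hj
  · simpa [Function.update_of_ne hji] using hj

/-- The lower rescaling sends the cube onto the lower piece (`0 < c ≤ 1`). [folklore] -/
theorem image_lowerMapAt_cube {M : ℕ} (i : Fin M) {c : ℝ} (hc : 0 < c) (hc1 : c ≤ 1) :
    (fun x : Fin M → ℝ => Function.update x i (c * x i)) '' cube M =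
      {x : Fin M → ℝ | x ∈ cube M ∧ x i ≤ c} := by
  ext y
  simp only [mem_image, mem_setOf_eq]
  constructor
  · rintro ⟨x, hx, rfl⟩
    have hxi := mem_cube.1 hx i
    refine ⟨update_mem_cube hx i (by nlinarith) (by nlinarith), ?_⟩
    simp only [Function.update_self]
    nlinarith
  · rintro ⟨hy, hyi⟩
    have hyi' := mem_cube.1 hy i
    refine ⟨Function.update y i (y i / c), update_mem_cube hy i
      (div_nonneg hyi'.1 hc.le) ((div_le_one hc).mpr hyi), ?_⟩
    ext j
    by_cases hji : j = i
    · subst hji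
      simp only [Function.update_self]
      field_simp
    · simp [Function.update_of_ne hji]

/-- The upper rescaling sends the cube onto the upper piece (`0 ≤ c < 1`). [folklore] -/
theorem image_upperMapAt_cube {M : ℕ} (i : Fin M) {c : ℝ} (hc : 0 ≤ c) (hc1 : c < 1) :
    (fun x : Fin M → ℝ => Function.update x i (c + (1 - c) * x i)) '' cube M =
      {x : Fin M → ℝ | x ∈ cube M ∧ c ≤ x i} := by
  have h1c : 0 < 1 - c := by linarith
  ext y
  simp only [mem_image, mem_setOf_eq]
  constructor
  · rintro ⟨x, hx, rfl⟩
    have hxi := mem_cube.1 hx i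
    refine ⟨update_mem_cube hx i (by nlinarith) (by nlinarith), ?_⟩
    simp only [Function.update_self]
    nlinarith
  · rintro ⟨hy, hyi⟩
    have hyi' := mem_cube.1 hy i
    refine ⟨Function.update y i ((y i - c) / (1 - c)), update_mem_cube hy i
      (div_nonneg (by linarith) h1c.le) ((div_le_one h1c).mpr (by linarith [hyi'.2])), ?_⟩
    ext j
    by_cases hji : j = i
    · subst hji
      simp only [Function.update_self]
      field_simp
      ring
    · simp [Function.update_of_ne hji]

/-- The lower rescaling (rational `c`) is a polynomial map over `ℚ`, hence `ℚ`-semialgebraic on the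
cube. [cite: BochnakCosteRoy1998, §2.2] -/
theorem isSemialgebraicMapOn_lowerMapAt {M : ℕ} (i : Fin M) (c : ℚ) :
    IsSemialgebraicMapOn ℚ (cube M) (fun x : Fin M → ℝ => Function.update x i ((c:ℝ) * x i)) := by
  refine (isSemialgebraicMapOn_aeval (R := ℝ) isSemialgebraic_cube fun j : Fin M =>
    if j = i then C c * X i else (X j : MvPolynomial (Fin M) ℚ)).congr fun x _ => ?_
  ext j
  by_cases hji : j = i
  · subst hji
    simp
  · simp [hji]

/-- The upper rescaling (rational `c`) is a polynomial map over `ℚ`, hence `ℚ`-semialgebraic on the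
cube. [cite: BochnakCosteRoy1998, §2.2] -/
theorem isSemialgebraicMapOn_upperMapAt {M : ℕ} (i : Fin M) (c : ℚ) :
    IsSemialgebraicMapOn ℚ (cube M)
      (fun x : Fin M → ℝ => Function.update x i ((c:ℝ) + (1 - (c:ℝ)) * x i)) := by
  refine (isSemialgebraicMapOn_aeval (R := ℝ) isSemialgebraic_cube fun j : Fin M =>
    if j = i then C c + (1 - C c) * X i else (X j : MvPolynomial (Fin M) ℚ)).congr fun x _ => ?_
  ext j
  by_cases hji : j = i
  · subst hji
    simp
  · simp [hji]

/-! ## The registered sub-goal stub -/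

/-- **Stub `stub_subdivAt`** (tool for growth deliverable G5 of the stub plan, registered on the crux):
**subdivision of the cube at a rational height as relations.** For a regular rational function `T` on
`[0,1]ᴹ`, a coordinate `i` and a rational `0 < c < 1`, and regular rational functions `S₁, S₂` with
`S₁(x) = c · T(x with xᵢ := c xᵢ)` and `S₂(x) = (1 − c) · T(x with xᵢ := c + (1 − c) xᵢ)` on the cube,
`[□ᴹ, T] − [□ᴹ, S₁] − [□ᴹ, S₂] ∈ KZ.relations`: domain additivity across the null hyperplane
`xᵢ = c` and two change-of-variables moves along the affine rescalings of Jacobians `c`, `1 − c`.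
[cite: KontsevichZagier2001, §1.2 rules (1), (2)] -/
theorem stub_subdivAt :
    ∀ (M : ℕ) (i : Fin M) (c : ℚ), 0 < c → c < 1 → ∀ (T S₁ S₂ : RFun M),
      (∀ x ∈ cube M, S₁.fn x = (c : ℝ) * T.fn (Function.update x i ((c : ℝ) * x i))) →
      (∀ x ∈ cube M, S₂.fn x =
        (1 - (c : ℝ)) * T.fn (Function.update x i ((c : ℝ) + (1 - (c : ℝ)) * x i))) →
      KZ.of T.rep - KZ.of S₁.rep - KZ.of S₂.rep ∈ KZ.relations := by
  intro M i c hc0 hc1 T S₁ S₂ h₁ h₂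
  have hc0' : (0:ℝ) < (c:ℝ) := by exact_mod_cast hc0
  have hc1' : (c:ℝ) < 1 := by exact_mod_cast hc1
  have hLsub : {x : Fin M → ℝ | x ∈ cube M ∧ x i ≤ (c:ℝ)} ⊆ T.rep.domain := fun x hx => hx.1
  have hUsub : {x : Fin M → ℝ | x ∈ cube M ∧ (c:ℝ) ≤ x i} ⊆ T.rep.domain := fun x hx => hx.1
  set rL : IntegralRep M := T.rep.restrict _ (isSemialgebraic_lowerAt i c) hLsub with hrL
  set rU : IntegralRep M := T.rep.restrict _ (isSemialgebraic_upperAt i c) hUsub with hrU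
  -- move (1a): `[T] − [rL] − [rU]`
  have hadd : KZ.of T.rep - KZ.of rL - KZ.of rU ∈ KZ.relations := by
    refine domainAddRel_subset_relations ⟨M, T.rep, rL, rU, ?_, ?_, ?_, ?_, rfl⟩
    · rw [hrL, hrU, IntegralRep.domain_restrict, IntegralRep.domain_restrict,
        lowerAt_union_upperAt]
      rfl
    · rw [hrL, hrU, IntegralRep.domain_restrict, IntegralRep.domain_restrict]
      exact volume_lowerAt_inter_upperAt i _
    · exact fun _ _ => rfl
    · exact fun _ _ => rfl
  -- move (2) for the lower piece: `[S₁] − [rL]`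
  have hcov₁ : KZ.of S₁.rep - KZ.of rL ∈ KZ.relations := by
    refine changeOfVariablesRel_subset_relations
      ⟨M, S₁.rep, rL, fun x : Fin M → ℝ => Function.update x i ((c:ℝ) * x i),
        fun _ => LinearMap.toContinuousLinearMap
          (Matrix.toLin' (Matrix.diagonal fun j : Fin M => if j = i then (c:ℝ) else 1)),
        isSemialgebraicMapOn_lowerMapAt i c, fun x _ => ?_, (lowerMapAt_injective i hc0'.ne').injOn,
        ?_, fun x hx => ?_, rfl⟩
    · rw [lowerMapAt_eq]
      exact (LinearMap.toContinuousLinearMap _).hasFDerivWithinAt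
    · rw [hrL, IntegralRep.domain_restrict, RFun.rep_domain, image_lowerMapAt_cube i hc0' hc1'.le]
    · rw [RFun.rep_integrand, h₁ x hx, hrL, IntegralRep.integrand_restrict, det_scaleAt,
        abs_of_pos hc0', mul_comm]
      rfl
  -- move (2) for the upper piece: `[S₂] − [rU]`
  have hcov₂ : KZ.of S₂.rep - KZ.of rU ∈ KZ.relations := by
    refine changeOfVariablesRel_subset_relations
      ⟨M, S₂.rep, rU, fun x : Fin M → ℝ => Function.update x i ((c:ℝ) + (1 - (c:ℝ)) * x i),
        fun _ => LinearMap.toContinuousLinearMap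
          (Matrix.toLin' (Matrix.diagonal fun j : Fin M => if j = i then (1 - (c:ℝ)) else 1)),
        isSemialgebraicMapOn_upperMapAt i c, fun x _ => ?_,
        (upperMapAt_injective i hc1'.ne).injOn, ?_, fun x hx => ?_, rfl⟩
    · rw [upperMapAt_eq]
      exact (LinearMap.toContinuousLinearMap _).hasFDerivWithinAt.add_const _
    · rw [hrU, IntegralRep.domain_restrict, RFun.rep_domain, image_upperMapAt_cube i hc0'.le hc1']
    · rw [RFun.rep_integrand, h₂ x hx, hrU, IntegralRep.integrand_restrict, det_scaleAt,
        abs_of_pos (by linarith), mul_comm]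
      rfl
  have heq : KZ.of T.rep - KZ.of S₁.rep - KZ.of S₂.rep =
      (KZ.of T.rep - KZ.of rL - KZ.of rU) - (KZ.of S₁.rep - KZ.of rL) - (KZ.of S₂.rep - KZ.of rU) := by
    abel
  rw [heq]
  exact KZ.relations.sub_mem (KZ.relations.sub_mem hadd hcov₁) hcov₂

section Chi

variable {R : Type} [CommRing R] {χ : KZ.FormalRep →+ R}
variable (hrel : ∀ c ∈ KZ.relations, χ c = 0)
include hrel

/-- `χ`-form of the subdivision at a rational height: `⟪T⟫ = ⟪S₁⟫ + ⟪S₂⟫`.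
[cite: KontsevichZagier2001, §1.2 rules (1), (2)] -/
theorem rfun_chi_subdivAt {M : ℕ} (i : Fin M) {c : ℚ} (hc0 : 0 < c) (hc1 : c < 1)
    (T S₁ S₂ : RFun M)
    (h₁ : ∀ x ∈ cube M, S₁.fn x = (c : ℝ) * T.fn (Function.update x i ((c : ℝ) * x i)))
    (h₂ : ∀ x ∈ cube M, S₂.fn x =
      (1 - (c : ℝ)) * T.fn (Function.update x i ((c : ℝ) + (1 - (c : ℝ)) * x i))) :
    T.chi χ = S₁.chi χ + S₂.chi χ := by
  have h := hrel _ (stub_subdivAt M i c hc0 hc1 T S₁ S₂ h₁ h₂)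
  rw [map_sub, map_sub] at h
  simp only [RFun.chi]
  linear_combination h

end Chi

end Summit.KontsevichZagierPeriods.HermiteRigidity.ReductionRigidity

end
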